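import Summits.CriticalPhenomena.PercolationContinuityZ3.Theorems.PercTiltedBlockersTiltSquaring
import HarnessLib

/-!
# Route `PercTiltedBlockers`, item `WideBoxFromTilt` (stmt-CriticalPhenomena-6396)

Settles the route decl
`Summit.CriticalPhenomena.PercolationContinuityZ3.Theses.PercTiltedBlockers.WideBoxFromTilt`
(`wideBoxFromTilt_proof`): at `p = p_c(ℤ³)`, TiltComparison on the shape family
`R(4m; L, M) = [0,4m]×[0,L]×[0,M]`, `L, M ∈ [4m, 24m]`, together with the cube seed
`P(n-cube blocked) ≥ c₀ > 0`, gives `P(R(4m; 24m, 24m) blocked) ≥ c > 0` for every `m ≥ 1`.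

Proof (the route's one-scale walk; template Tassion 2016, §2; Grimmett 1999, §1.6 for the lattice
symmetries of `P_p`). Write `β(L,M) := P(R(4m;L,M) blocked)`.
* `tilt_step` — `c ≤ β(L,M)`, `c > 0` ⇒ `g(c)² ≤ β(L+m,M)` on the shape family: TiltComparison gives a
  level `a` with `P(Tilt(R(4m;L,M); m, a)) ≥ g(β(L,M)) ≥ g(c) > 0` (`g` monotone, positive on
  `(0,∞)`), and TiltSquaring with `δ = m` (`tiltSquaring_proof`,
  `PercTiltedBlockersTiltSquaring.lean`) gives `β(L+m,M) ≥ P(Tilt)²`.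
* `tilt_real_blocked_swap` — `P_p(R(h;L,M) blocked) = P_p(R(h;M,L) blocked)` (swap of the two
  horizontal axes, the automorphism `zdSignedPermIso (swap 1 2) 1`;
  `bondPercolation_real_preimage_relabel_iso`).
* `tilt_iterate` — the arithmetic of the walk for an abstract `B(h,L,M)`: from `B(4m,4m,4m) ≥ c₀`
  walk `L = 4m → 24m` at `M = 4m` (20 steps), swap the axes, walk again at `M = 24m`;
  `c := c₄₀`, `c_{k+1} = g(c_k)²`, independent of `m`.
* `wideBoxFromTilt_proof` — instantiate `B` with the blocking probability at `p_c(ℤ³)`.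
-/

namespace Summit.CriticalPhenomena.PercolationContinuityZ3.Theorems

open Literature.Probability.Percolation Literature.Probability.LatticeModels

/-! ## The one-scale iteration: `WideBoxFromTilt` -/

section Iteration

open MeasureTheory

/-- Lattice symmetries preserve the probability of "no open crossing" events:
`P_p((C(φS; φA, φB))ᶜ) = P_p((C(S; A, B))ᶜ)` for an automorphism `φ` of `ℤ³`
(`bondPercolation_real_preimage_relabel_iso`, no measurability needed). [folklore] -/
theorem tilt_real_compl_openCrossing_image (φ : zdGraph 3 ≃g zdGraph 3) (p : unitInterval)
    (S A B : Set (Site 3)) :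
    (bondPercolation (zdGraph 3) p).real (openCrossing (φ '' S) (φ '' A) (φ '' B))ᶜ =
      (bondPercolation (zdGraph 3) p).real (openCrossing S A B)ᶜ := by
  rw [← bondPercolation_real_preimage_relabel_iso φ p, Set.preimage_compl]
  exact congrArg (fun s => (bondPercolation (zdGraph 3) p).real sᶜ)
    (preimage_relabel_openCrossing φ.toEquiv S A B)

/-- Swapping the two horizontal axes (`zdSignedPermIso (swap 1 2) 1`, a lattice automorphism)
preserves the blocking probability of a box: `P_p(R(h;L,M) blocked) = P_p(R(h;M,L) blocked)`.
[folklore] -/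
theorem tilt_real_blocked_swap (p : unitInterval) (hh LL MM : ℤ) :
    (bondPercolation (zdGraph 3) p).real {ω | ¬ ∃ x ∈ Finset.Icc (0 : Site 3) ![hh, LL, MM],
        ∃ y ∈ Finset.Icc (0 : Site 3) ![hh, LL, MM],
        x 0 = 0 ∧ y 0 = hh ∧ ω ∈ openConnIn ↑(Finset.Icc (0 : Site 3) ![hh, LL, MM]) x y} =
      (bondPercolation (zdGraph 3) p).real {ω | ¬ ∃ x ∈ Finset.Icc (0 : Site 3) ![hh, MM, LL],
        ∃ y ∈ Finset.Icc (0 : Site 3) ![hh, MM, LL],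
        x 0 = 0 ∧ y 0 = hh ∧ ω ∈ openConnIn ↑(Finset.Icc (0 : Site 3) ![hh, MM, LL]) x y} := by
  rw [TiltSquaring.event_eq_compl (Finset.Icc (0 : Site 3) ![hh, LL, MM]) (fun x => x 0 = 0)
      (fun y => y 0 = hh),
    TiltSquaring.event_eq_compl (Finset.Icc (0 : Site 3) ![hh, MM, LL]) (fun x => x 0 = 0)
      (fun y => y 0 = hh)]
  set φ : zdGraph 3 ≃g zdGraph 3 := zdSignedPermIso (Equiv.swap (1 : Fin 3) 2) 1 with hφ
  have hφc : ∀ x : Site 3, φ x 0 = x 0 ∧ φ x 1 = x 2 ∧ φ x 2 = x 1 := by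
    intro x
    simp [hφ, Equiv.swap_apply_of_ne_of_ne, Equiv.swap_apply_left, Equiv.swap_apply_right,
      Equiv.symm_swap]
  have hinv : ∀ x : Site 3, φ (φ x) = x := by
    intro x
    obtain ⟨h0, h1, h2⟩ := hφc x
    obtain ⟨h0', h1', h2'⟩ := hφc (φ x)
    exact TiltSquaring.vec3_ext (h0'.trans h0) (h1'.trans h2) (h2'.trans h1)
  have h1 : φ '' (↑(Finset.Icc (0 : Site 3) ![hh, MM, LL]) : Set (Site 3)) =
      ↑(Finset.Icc (0 : Site 3) ![hh, LL, MM]) := by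
    refine TiltSquaring.image_eq_of_invol hinv fun x => ?_
    obtain ⟨h0, h1, h2⟩ := hφc x
    simp only [Finset.mem_coe, TiltSquaring.mem_box0, h0, h1, h2]
    tauto
  have h2 : φ '' {x | x ∈ Finset.Icc (0 : Site 3) ![hh, MM, LL] ∧ x 0 = 0} =
      {x | x ∈ Finset.Icc (0 : Site 3) ![hh, LL, MM] ∧ x 0 = 0} := by
    refine TiltSquaring.image_eq_of_invol hinv fun x => ?_
    obtain ⟨h0, h1, h2⟩ := hφc x
    simp only [Set.mem_setOf_eq, TiltSquaring.mem_box0, h0, h1, h2]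
    tauto
  have h3 : φ '' {y | y ∈ Finset.Icc (0 : Site 3) ![hh, MM, LL] ∧ y 0 = hh} =
      {y | y ∈ Finset.Icc (0 : Site 3) ![hh, LL, MM] ∧ y 0 = hh} := by
    refine TiltSquaring.image_eq_of_invol hinv fun x => ?_
    obtain ⟨h0, h1, h2⟩ := hφc x
    simp only [Set.mem_setOf_eq, TiltSquaring.mem_box0, h0, h1, h2]
    tauto
  rw [← h1, ← h2, ← h3]
  exact tilt_real_compl_openCrossing_image φ p _ _ _

/-- One squaring step at `p = p_c(ℤ³)` on the shape family `h = 4m`, `L, M ∈ [4m, 24m]`: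
if `c ≤ P(R(4m;L,M) blocked)` with `c > 0` then `g(c)² ≤ P(R(4m;L+m,M) blocked)`
(tilt comparison at the level `a` it provides, then `tiltSquaring_proof` with `δ = m`,
monotonicity and positivity of `g`). [folklore] -/
theorem tilt_step {g : ℝ → ℝ} (hgmono : Monotone g) (hgpos : ∀ s, 0 < s → 0 < g s)
    (hT : ∀ m L M : ℕ, 1 ≤ m → 4 * m ≤ L → L ≤ 24 * m → 4 * m ≤ M → M ≤ 24 * m → ∃ a : ℕ,
      g ((bondPercolation (zdGraph 3) (criticalProbI 3)).real {ω | ¬ ∃ x ∈ Finset.Icc (0 : Site 3) ![4 * (m : ℤ), L, M],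
        ∃ y ∈ Finset.Icc (0 : Site 3) ![4 * (m : ℤ), L, M], x 0 = 0 ∧ y 0 = 4 * m ∧
          ω ∈ openConnIn ↑(Finset.Icc (0 : Site 3) ![4 * (m : ℤ), L, M]) x y}) ≤
      (bondPercolation (zdGraph 3) (criticalProbI 3)).real {ω | ¬ ∃ x ∈ Finset.Icc (0 : Site 3) ![4 * (m : ℤ), L, M],
        ∃ y ∈ Finset.Icc (0 : Site 3) ![4 * (m : ℤ), L, M], (x 0 = 0 ∨ (x 1 = L ∧ x 0 < a)) ∧
          (y 0 = 4 * m ∨ (y 1 = m ∧ (a : ℤ) ≤ y 0)) ∧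
          ω ∈ openConnIn ↑(Finset.Icc (0 : Site 3) ![4 * (m : ℤ), L, M]) x y})
    {m L M : ℕ} (hm : 1 ≤ m) (hL : 4 * m ≤ L) (hL' : L ≤ 24 * m) (hM : 4 * m ≤ M) (hM' : M ≤ 24 * m)
    {c : ℝ} (hc : 0 < c)
    (hcle : c ≤ (bondPercolation (zdGraph 3) (criticalProbI 3)).real {ω | ¬ ∃ x ∈ Finset.Icc (0 : Site 3) ![4 * (m : ℤ), L, M],
        ∃ y ∈ Finset.Icc (0 : Site 3) ![4 * (m : ℤ), L, M], x 0 = 0 ∧ y 0 = 4 * m ∧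
          ω ∈ openConnIn ↑(Finset.Icc (0 : Site 3) ![4 * (m : ℤ), L, M]) x y}) :
    (g c) ^ 2 ≤ (bondPercolation (zdGraph 3) (criticalProbI 3)).real {ω | ¬ ∃ x ∈ Finset.Icc (0 : Site 3) ![4 * (m : ℤ), ((L + m : ℕ) : ℤ), M],
        ∃ y ∈ Finset.Icc (0 : Site 3) ![4 * (m : ℤ), ((L + m : ℕ) : ℤ), M], x 0 = 0 ∧ y 0 = 4 * m ∧
          ω ∈ openConnIn ↑(Finset.Icc (0 : Site 3) ![4 * (m : ℤ), ((L + m : ℕ) : ℤ), M]) x y} := by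
  obtain ⟨a, ha⟩ := hT m L M hm hL hL' hM hM'
  have hsq := tiltSquaring_proof (criticalProbI 3) (4 * m) L M m a (by omega)
  have h4 : ((4 * m : ℕ) : ℤ) = 4 * (m : ℤ) := by rw [Nat.cast_mul, Nat.cast_ofNat]
  rw [h4] at hsq
  exact (pow_le_pow_left₀ (hgpos c hc).le ((hgmono hcle).trans ha) 2).trans hsq

/-- The finite iteration behind `WideBoxFromTilt`, as a statement about a function
`B(h, L, M)` (the blocking probability of `R(h;L,M)`): from the seed `B(4m,4m,4m) ≥ c₀`, the step
`c ≤ B(4m,L,M) ⇒ g(c)² ≤ B(4m,L+m,M)` on the shape family and the symmetry `B(4m,L,M) = B(4m,M,L)`,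
forty steps give `B(4m,24m,24m) ≥ c₄₀ > 0` with `c_{k+1} = g(c_k)²` independent of `m`.
[folklore] -/
theorem tilt_iterate {B : ℤ → ℤ → ℤ → ℝ} {g : ℝ → ℝ} (hgpos : ∀ s, 0 < s → 0 < g s)
    {c₀ : ℝ} (hc₀ : 0 < c₀)
    (hseed : ∀ m : ℕ, 1 ≤ m → c₀ ≤ B ((4 * m : ℕ) : ℤ) ((4 * m : ℕ) : ℤ) ((4 * m : ℕ) : ℤ))
    (hstep : ∀ m L M : ℕ, 1 ≤ m → 4 * m ≤ L → L ≤ 24 * m → 4 * m ≤ M → M ≤ 24 * m →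
      ∀ c : ℝ, 0 < c → c ≤ B (4 * (m : ℤ)) L M → (g c) ^ 2 ≤ B (4 * (m : ℤ)) ((L + m : ℕ) : ℤ) M)
    (hswap : ∀ (m : ℕ) (LL MM : ℤ), B (4 * (m : ℤ)) LL MM = B (4 * (m : ℤ)) MM LL) :
    ∃ c : ℝ, 0 < c ∧ ∀ m : ℕ, 1 ≤ m → c ≤ B (4 * (m : ℤ)) (24 * (m : ℤ)) (24 * (m : ℤ)) := by
  set f : ℝ → ℝ := fun s => (g s) ^ 2 with hf
  have hfpos : ∀ s, 0 < s → 0 < f s := fun s hs => by rw [hf]; exact pow_pos (hgpos s hs) 2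
  have hcpos : ∀ k, 0 < f^[k] c₀ := by
    intro k
    induction k with
    | zero => simpa using hc₀
    | succ k ih => rw [Function.iterate_succ_apply']; exact hfpos _ ih
  -- first walk, `L = 4m → 24m` at `M = 4m`
  have walk1 : ∀ k, k ≤ 20 → ∀ m : ℕ, 1 ≤ m →
      f^[k] c₀ ≤ B (4 * (m : ℤ)) (((4 + k) * m : ℕ) : ℤ) ((4 * m : ℕ) : ℤ) := by
    intro k
    induction k with
    | zero =>
      intro _ m hm
      have e1 : ((4 + 0) * m : ℕ) = 4 * m := by ring
      have e2 : (4 * (m : ℤ)) = ((4 * m : ℕ) : ℤ) := by rw [Nat.cast_mul, Nat.cast_ofNat]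
      rw [e1, e2, Function.iterate_zero_apply]
      exact hseed m hm
    | succ k ih =>
      intro hk m hm
      have h := hstep m ((4 + k) * m) (4 * m) hm (Nat.mul_le_mul_right m (by omega))
        (Nat.mul_le_mul_right m (by omega)) le_rfl (by omega) _ (hcpos k) (ih (by omega) m hm)
      have e : ((4 + k) * m + m : ℕ) = (4 + (k + 1)) * m := by ring
      rw [e] at h
      rw [Function.iterate_succ_apply']
      exact h
  -- swap the horizontal axes
  have mid : ∀ m : ℕ, 1 ≤ m → f^[20] c₀ ≤ B (4 * (m : ℤ)) ((4 * m : ℕ) : ℤ) ((24 * m : ℕ) : ℤ) := by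
    intro m hm
    have h := walk1 20 le_rfl m hm
    have e : ((4 + 20) * m : ℕ) = 24 * m := by ring
    rw [e] at h
    rw [hswap]; exact h
  -- second walk, `L = 4m → 24m` at `M = 24m`
  have walk2 : ∀ k, k ≤ 20 → ∀ m : ℕ, 1 ≤ m →
      f^[20 + k] c₀ ≤ B (4 * (m : ℤ)) (((4 + k) * m : ℕ) : ℤ) ((24 * m : ℕ) : ℤ) := by
    intro k
    induction k with
    | zero =>
      intro _ m hm
      have e1 : ((4 + 0) * m : ℕ) = 4 * m := by ring
      rw [e1]; exact mid m hm
    | succ k ih =>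
      intro hk m hm
      have h := hstep m ((4 + k) * m) (24 * m) hm (Nat.mul_le_mul_right m (by omega))
        (Nat.mul_le_mul_right m (by omega)) (by omega) le_rfl _ (hcpos (20 + k)) (ih (by omega) m hm)
      have e : ((4 + k) * m + m : ℕ) = (4 + (k + 1)) * m := by ring
      rw [e] at h
      rw [show 20 + (k + 1) = (20 + k) + 1 by ring, Function.iterate_succ_apply']
      exact h
  refine ⟨f^[40] c₀, hcpos 40, fun m hm => ?_⟩
  have e2 : ((24 * m : ℕ) : ℤ) = 24 * (m : ℤ) := by rw [Nat.cast_mul, Nat.cast_ofNat]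
  rw [← e2]
  -- `(4 + 20) * m` and `24 * m`, `20 + 20` and `40` agree definitionally
  exact walk2 20 le_rfl m hm

/-- **`WideBoxFromTilt`** (route `PercTiltedBlockers`, item stmt-CriticalPhenomena-6396): at
`p = p_c(ℤ³)`, tilt comparison on the shape family `R(4m; L, M)`, `L, M ∈ [4m, 24m]`, and the
cube seed `P(n-cube blocked) ≥ c₀` give `P(R(4m;24m,24m) blocked) ≥ c > 0` for all `m ≥ 1`:
`β(L+m,M) ≥ g(β(L,M))²` by `tilt_step` (tilt squaring with `δ = m`), twenty steps from the seed
`β(4m,4m) ≥ c₀` at `M = 4m`, the swap `x₁ ↔ x₂` (`tilt_real_blocked_swap`), and twenty more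
steps at `M = 24m`; the constants `c_{k+1} = g(c_k)²` do not depend on `m` (`tilt_iterate`).
[folklore] -/
theorem wideBoxFromTilt_proof :
    Summit.CriticalPhenomena.PercolationContinuityZ3.Theses.PercTiltedBlockers.WideBoxFromTilt := by
  rintro ⟨g, hgmono, hgpos, hT⟩ ⟨c₀, hc₀, hS⟩
  exact tilt_iterate (B := fun hh LL MM => (bondPercolation (zdGraph 3) (criticalProbI 3)).real
      {ω | ¬ ∃ x ∈ Finset.Icc (0 : Site 3) ![hh, LL, MM], ∃ y ∈ Finset.Icc (0 : Site 3) ![hh, LL, MM],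
        x 0 = 0 ∧ y 0 = hh ∧ ω ∈ openConnIn ↑(Finset.Icc (0 : Site 3) ![hh, LL, MM]) x y})
    hgpos hc₀ (fun m hm => hS (4 * m) (by omega))
    (fun m L M hm hL hL' hM hM' c hc hcle => tilt_step hgmono hgpos hT hm hL hL' hM hM' hc hcle)
    (fun m LL MM => tilt_real_blocked_swap (criticalProbI 3) _ LL MM)

end Iteration

end Summit.CriticalPhenomena.PercolationContinuityZ3.Theorems
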